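import Summits.Ventures.QEC.Census.CertBZPlaneTop
import HarnessLib

/-!
# MIXED lane families for the Brouwer–Zimmermann lane engine: largest-row segments below a cut, top families above it

Venture QEC (cell `qec`), qec-type-01 gen 4 (census KERNEL-upgrade lane, director-qec R33). `Census/CertBZPlaneSound.lean`
(qec-type-01) replays an enumeration matrix `G` by `segment t m₀ s` families — all selections of `≤ t` rows with largest row
in `[m₀, m₀+s)` —, and a single largest row `m` cannot be split further: at depth `t = 6` the family of row `m` alone has
`C(m, ≤ 5)` lanes (`1.13·10⁷` at `m = 68`, beyond what one `decide +kernel` declaration replays on the farm).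
`Census/CertBZPlaneTop.lean` (qec-search-5) splits instead by the selection's intersection `P` with the TOP rows `[c, c+k)`,
which is fine-grained for the top rows but puts every selection below `c` into ONE family. This file combines the two,
with no new definition: **`reaches_of_segsTops`** — if the segments cover the largest rows `< c` (`segOK`, qec-type-01) and,
for every NON-EMPTY `P ⊆ [c, c+k)` with `|P| ≤ T`, the top family with budget `T − |P|` passes (`topOK`, qec-search-5), then
`Reaches (bzLeaf wmax allow) (rowPos G 0) T 0 0` — the conclusion of `reaches_of_segList` / `reaches_of_topFamilies`, so
`matrixEnumOK_of_reaches` / `DistCert.bzZEnum_of_reaches` apply verbatim. The shared last step of both soundness proofs is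
isolated as `leaf_of_familyOK_covers` (a passing family whose lane `b` spells the selection `J` gives the leaf at `J`).
Typical use (abelian two-block rows with `kb = 69`, depth 6): segments for rows `< 65`, `k = 4` top rows ⇒ 15 top families of
`≤ 9.0·10⁶` lanes instead of three single-row families of `0.97–1.13·10⁷`. Theorems only; standard axioms.
-/

set_option autoImplicit false

namespace Summit.Ventures.QEC.Census.Plane

open List

/-- **A passing family that covers a selection gives the leaf there.** If `familyOK wmax (range n) allow G fam (wmax+1) fuel`
passes and lane `b < N` of `fam` selects exactly the (strictly increasing, in-range) row list `J`, then the tree's leaf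
`bzLeaf wmax allow` holds at the selection word / codeword of `J`. (The common final step of `reaches_of_segOK` and
`reaches_of_topFamilies`.) -/
theorem leaf_of_familyOK_covers (n wmax : ℕ) (allow G : List ℕ) (fuel : ℕ) (hG : ∀ g ∈ G, g < 2 ^ n)
    (fam : ℕ × List ℕ) (hfam : familyOK wmax (List.range n) allow G fam (wmax + 1) fuel = true)
    (J : List ℕ) (hJp : J.Pairwise (· < ·)) (hJlt : ∀ j ∈ J, j < G.length)
    {b : ℕ} (hb : b < fam.1) (hbits : ∀ i, (fam.2.getD i 0).testBit b = decide (i ∈ J)) :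
    bzLeaf wmax allow (xorFst (J.map fun j => (2 ^ j, G.getD j 0))) (xorSnd (J.map fun j => (2 ^ j, G.getD j 0))) =
      true := by
  have hsel := laneSel_eq_of_covers b G fam.2 J hJp hbits hJlt
  rcases familyOK_sound (Nat.succ_pos wmax) hfam b hb with hcnt | hleaf
  · -- at least `wmax + 1` set bits among the columns `0 … n-1`: the fast weight test fires
    rw [hsel] at hcnt
    simp only at hcnt
    rw [length_filter_range_testBit] at hcnt
    have hclt : xorSnd (J.map fun j => (2 ^ j, G.getD j 0)) < 2 ^ n := by
      rw [xorSnd_map_pair]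
      refine xorList_lt n _ fun x hx => ?_
      obtain ⟨j, hj, rfl⟩ := List.mem_map.1 hx
      have hjl := hJlt j hj
      rw [List.getD_eq_getElem?_getD, List.getElem?_eq_getElem hjl, Option.getD_some]
      exact hG _ (List.getElem_mem hjl)
    have hwt := wtGt_of_lt_popc n wmax _ hclt (by omega)
    rw [bzLeaf, hwt]
    simp only [Bool.or_true, Bool.true_or]
  · -- a straggler: the tree's leaf was evaluated on exactly this selection
    rw [hsel] at hleaf
    exact hleaf

/-- **SOUNDNESS OF THE MIXED REPLAY.** Let the rows of `G` (`|G| = c + k`) be words below `2^n`. Suppose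
(i) every row index `m < c` lies in a listed segment `[m₀, m₀+s)` (`hcov`, by `decide`) and every listed segment passes
`segOK n wmax allow G T m₀ s fuel` (one `decide +kernel` theorem each), and (ii) every NON-EMPTY set `P` of top rows
(sublist of `range' c k`) with `|P| ≤ T` is listed in `L` (`hL`, by `decide`) and its top family with budget `T − |P|` passes
`topOK n wmax allow G c (T − |P|) k P fuel`. Then `Reaches (bzLeaf wmax allow) (rowPos G 0) T 0 0`: the leaf holds at every
sub-selection of `≤ T` rows — a selection below `c` has its largest row in a segment, a selection meeting the top rows is in
the top family of its top part. -/
theorem reaches_of_segsTops (n wmax : ℕ) (allow G : List ℕ) (c k T fuel : ℕ) (hG : ∀ g ∈ G, g < 2 ^ n)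
    (hlen : G.length = c + k) (segs : List (ℕ × ℕ))
    (hcov : ((List.range c).all fun m => segs.any fun p => decide (p.1 ≤ m) && decide (m < p.1 + p.2)) = true)
    (hseg : ∀ p ∈ segs, segOK n wmax allow G T p.1 p.2 fuel = true) (L : List (List ℕ))
    (hL : ((List.range' c k).sublists.all fun P => P.isEmpty || decide (T < P.length) || L.elem P) = true)
    (htop : ∀ P ∈ L, P.length ≤ T → topOK n wmax allow G c (T - P.length) k P fuel = true) :
    Reaches (bzLeaf wmax allow) (rowPos G 0) T 0 0 := by
  intro S hS hSl
  rw [Nat.zero_xor, Nat.zero_xor]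
  obtain ⟨J, hJsub, rfl⟩ := exists_map_of_sublist_rowPos G hS
  have hJp : J.Pairwise (· < ·) := List.Pairwise.sublist hJsub List.pairwise_lt_range
  have hJlt : ∀ j ∈ J, j < G.length := fun j hj => List.mem_range.1 (hJsub.subset hj)
  rw [List.length_map] at hSl
  by_cases hlow : ∀ j ∈ J, j < c
  · -- (i) the whole selection lies below the cut: its largest row is in a passing segment
    rcases List.eq_nil_or_concat J with rfl | ⟨J', m, rfl⟩
    · simp [xorFst, xorSnd, xorList, bzLeaf]
    · rw [List.concat_eq_append] at hJp hJlt hSl hlow ⊢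
      have hm : m < c := hlow m (by simp)
      simp only [List.all_eq_true, List.mem_range, List.any_eq_true, Bool.and_eq_true, decide_eq_true_eq] at hcov
      obtain ⟨p, hp, h1, h2⟩ := hcov m hm
      have hJ'p : J'.Pairwise (· < ·) := (List.pairwise_append.1 hJp).1
      have hJ'm : ∀ j ∈ J', j < m := fun j hj =>
        (List.pairwise_append.1 hJp).2.2 j hj m (List.mem_singleton_self m)
      have hJ'l : J'.length ≤ T - 1 := by rw [List.length_append, List.length_singleton] at hSl; omega
      obtain ⟨b, hb, hbits⟩ := covers_segment T p.1 p.2 h1 h2 J' hJ'p hJ'm hJ'l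
      have hok := hseg p hp
      rw [segOK] at hok
      exact leaf_of_familyOK_covers n wmax allow G fuel hG _ hok _ hJp hJlt hb hbits
  · -- (ii) the selection meets the top rows: split it into prefix part and top part
    set J1 := J.filter fun j => decide (j < c) with hJ1
    set P := J.filter fun j => decide (c ≤ j) with hPdef
    have hJ1c : ∀ j ∈ J1, j < c := fun j hj => by simpa using (List.mem_filter.1 hj).2
    have hPc : ∀ p ∈ P, c ≤ p ∧ p < c + k := fun p hp => by
      obtain ⟨hpJ, hpc⟩ := List.mem_filter.1 hp
      exact ⟨by simpa using hpc, hlen ▸ hJlt p hpJ⟩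
    have hJ1p : J1.Pairwise (· < ·) := hJp.filter _
    have hPp : P.Pairwise (· < ·) := hJp.filter _
    have hPsub : P.Sublist (List.range' c k) := sublist_range'_of_pairwise c k P hPp hPc
    have hPne : P ≠ [] := by
      intro hP0
      apply hlow
      intro j hj
      by_contra hjc
      have : j ∈ P := by rw [hPdef]; exact List.mem_filter.2 ⟨hj, by simpa using Nat.not_lt.1 hjc⟩
      rw [hP0] at this
      simp at this
    have hlenJ : J1.length + P.length = J.length := by
      have e2 : ∀ j : ℕ, (!decide (j < c)) = decide (c ≤ j) := fun j => by
        by_cases h : j < c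
        · simp [h, Nat.not_le.2 h]
        · simp [h, Nat.not_lt.1 h]
      have h := List.length_eq_length_filter_add (fun j => decide (j < c)) (l := J)
      rw [List.filter_congr (fun j _ => e2 j)] at h
      rw [hJ1, hPdef]; exact h.symm
    have hPT : P.length ≤ T := by omega
    have hPL : P ∈ L := by
      rw [List.all_eq_true] at hL
      have h := hL P (List.mem_sublists.2 hPsub)
      have h1 : P.isEmpty = false := by
        cases hP : P with
        | nil => exact absurd hP hPne
        | cons _ _ => rfl
      have h2 : decide (T < P.length) = false := by simpa using hPT
      rw [h1, h2, Bool.false_or, Bool.false_or] at h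
      exact List.mem_of_elem_eq_true h
    have hfam := htop P hPL hPT
    rw [topOK] at hfam
    have hmem : ∀ i, (i ∈ J1 ++ P) ↔ i ∈ J := fun i => by
      rw [List.mem_append, hJ1, hPdef, List.mem_filter, List.mem_filter]
      constructor
      · rintro (⟨h, -⟩ | ⟨h, -⟩) <;> exact h
      · intro h; by_cases hic : i < c
        · exact Or.inl ⟨h, by simpa using hic⟩
        · exact Or.inr ⟨h, by simpa using Nat.not_lt.1 hic⟩
    obtain ⟨b, hb, hbits⟩ := covers_topFamily c (T - P.length) k P hPc J1 hJ1p hJ1c (by omega)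
    have hbits' : ∀ i, ((topFamily c (T - P.length) k P).2.getD i 0).testBit b = decide (i ∈ J) := fun i => by
      rw [hbits i]; exact Bool.decide_congr (hmem i)
    exact leaf_of_familyOK_covers n wmax allow G fuel hG _ hfam J hJp hJlt hb hbits'

/-! ## Control (the Steane matrix of `Census/CertBZPlaneTop.lean`: 4 rows of 7 bits; cut `c = 2`, `k = 2`, budget 2) -/

/-- Control (a statement not in the tree: budget `T = 1`): rows `0, 1` by one depth-1 segment, top rows `2, 3` by the
two singleton top families (the pair `[2, 3]` is skipped by the `T < |P|` escape); every single row of the Steane matrix has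
weight `≥ 3` (threshold `wmax = 2`). -/
theorem reaches_steane_mixed_one : Reaches (bzLeaf 2 []) (rowPos steaneG 0) 1 0 0 :=
  reaches_of_segsTops 7 2 [] steaneG 2 2 1 1 (by decide) (by decide) [(0, 2)] (by decide)
    (by intro p hp; simp only [List.mem_singleton] at hp; subst hp; decide)
    [[2], [3]] (by decide)
    (by
      intro P hP _
      simp only [List.mem_cons, List.not_mem_nil, or_false] at hP
      rcases hP with rfl | rfl <;> decide)

end Summit.Ventures.QEC.Census.Plane
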